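import Literature.IUT.HodgeTheaters.PiAvatarEvalSectionsOuterActions
import Literature.IUT.HodgeTheaters.PiAvatarKitCoreThetaOfBadPairs
import HarnessLib

/-!
# [IUTchI] Example 4.4 (ii), the outer-action clause «… for some [not necessarily unique, but determined up to finite ambiguity] outer isomorphism
# `π₁^geo(𝒟_{v_j}) ⥲ π₁^geo(𝒟_{>,v})`», and Example 4.5 (i), the bad-place clause — the AMBIGUITY of the named outer isomorphism CHARACTERISED in the
# Π-avatar (δ-generic group theory), and both clauses AT THE PARAMETRIC BAD-PAIR Θ-KIT `baseKitThetaNFOfBadPairs CG hS M hA hI B ΛBad` of the REAL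
# initial Θ-data (proof-only; abc-iut-L5-t3 lineage, support row «EX44II-OUTER-ACTIONS-AT-OFBADPAIRS»)

S. Mochizuki, *Inter-universal Teichmüller theory I*, kurims manuscript (May 2020), Example 4.4 (ii) p. 107 l. 7–17 («for each constituent morphism
`𝒟_{v_j} → 𝒟_{>,v}` of the poly-morphism `φ^Θ_{v_j}`, the induced homomorphism `π₁(𝒟_{v_j}) → π₁(𝒟_{>,v})` [well-defined, up to composition with an inner
automorphism] is compatible with the respective outer actions [of the domain and codomain of this homomorphism] on `π₁^geo(𝒟_{v_j})`, `π₁^geo(𝒟_{>,v})` for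
some [not necessarily unique, but determined up to finite ambiguity — cf. [SemiAnbd], Theorem 6.4!] outer isomorphism `π₁^geo(𝒟_{v_j}) ⥲ π₁^geo(𝒟_{>,v})`»),
Example 4.5 (i) p. 108 l. 25–31 («the data of the arrow `φ^Θ_j : 𝔇_j → 𝔇_>` at the various `v ∈ 𝕍` determines an isomorphism of `𝔽_l^⋇`-torsors
`LabCusp(𝔇_j) ⥲ LabCusp(𝔇_>)` … when `v ∈ 𝕍^bad`, it follows immediately from the discussion of Example 4.4, (ii)»), Example 4.4 (iv) p. 107, Def 4.1 (ii)
p. 96, Prop 4.2 p. 98 ([IUTchI] Ex 4.4 (ii) p.107) [claim: Mochizuki2012, status: disputed] (D-0012 claim key, series status DISPUTED — kernel theorems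
over abc-iut-L5-t2's REAL `InitialThetaData`, abc-iut-L5-t4's local data `δ : D.LocalDatum CG hS` / genuine-shape Θ-NF kit `baseKitThetaNFOfBadPairs`
(p465512), abc-iut-L5-t3's evaluation-section DATA `EvalSections` (p456293) and outer-action theorems `PiAvatarEvalSectionsOuterActions` (p490176),
abc-iut-w5-d129's §4 datum `baseThetaDatumThetaOfBadPairs B ΛBad ES` (p491670); nothing of the series is asserted, no side is taken on [IUTchIII] Cor. 3.12).

## What this file adds (abc-iut-L5-t3 gen 9)

(1) **The ambiguity bracket of Example 4.4 (ii), made precise in the avatar (§1–§2, δ-generic).**  `PiAvatarEvalSectionsOuterActions` (p490176) proved,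
for every constituent `f ∈ thetaClass j` of `φ^Θ_{v̲_j}` and every representative `ψ : Π_v̲ → Π_v̲` of `f`, that there is an *admissible* `a ∈ N_{Π_{C_F}}(Π_v̲)`
— i.e. `ψ(g) = a⁻¹ g a · d_g` with `d_g ∈ Δ_v̲ := Π_v̲ ∩ Δ_{C_F}` for all `g ∈ Π_v̲`, so that the outer isomorphism `x ↦ a⁻¹xa` of `π₁^geo = Δ_v̲` is the one
through which `ψ` is «compatible with the respective outer actions» — and NAMED one.  Here (pure group theory over {`δ.H`, `D.DeltaC = Ker augGF`}):
* `LocalDatum.augGF_rep_eq_of_admissible`: an admissible `a` computes the `G_F`-shadow of `ψ`: `aug(ψ g) = aug(a)⁻¹ aug(g) aug(a)`;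
* `LocalDatum.commute_augGF_of_admissible`: two admissible `a`, `a′` for the SAME representative `ψ` differ by `b := a′a⁻¹` with `aug(b)` CENTRALISING
  `G_v̲ := aug(Π_v̲)` in `G_F`; `InitialThetaData.commute_augGF_iff_mem_DeltaC`: equivalently `b⁻¹g⁻¹bg ∈ Δ_{C_F}` for all `g ∈ Π_v̲`;
* `LocalDatum.admissible_mul_of_commute_augGF`: conversely every `b ∈ N(Π_v̲)` with `aug(b) ∈ Z_{G_F}(G_v̲)` gives an admissible `b·a`;
* `LocalDatum.outerIso_admissible_iff`: **the set of admissible elements is EXACTLY the coset `A·a`** of the subgroup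
  `A = {b ∈ N(Π_v̲) | aug(b) ∈ Z_{G_F}(G_v̲)}` ⊇ `N_{Δ_{C_F}}(Π_v̲)` (`admissible_mul_of_mem_DeltaC`) — this is the avatar's form of print's bracket
  «not necessarily unique, but determined up to finite ambiguity»; changing the representative `ψ` by an inner automorphism of `Π_v̲` moves the coset by
  `Π_v̲` (`admissible_mul_inv_of_innerEquiv`);
* `EvalSections.outerAction_compatible_ambiguity_of_mem_thetaClass`: (α) + the exact ambiguity + (β) for EVERY element of `N(Π_v̲)` (slope class `1`), so
  the bijection `LabCusp(𝒟_{v̲_j}) ⥲ LabCusp(𝒟_{>,v̲})` of Example 4.5 (i) induced through ANY admissible outer isomorphism is the SAME (the identity on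
  Prop 4.2's canonical labels) — the well-definedness print's «determines an isomorphism of `𝔽_l^⋇`-torsors» uses at `v ∈ 𝕍^bad`.
HONEST LABEL: FINITENESS of the ambiguity (print: [SemiAnbd] Thm 6.4 on the `π₁^geo`-side; on the `G`-side the classical «`Z_{G_F}(G_v̲) = 1`», which
would cut `A` down to `N_{Δ_{C_F}}(Π_v̲)`) is NOT asserted here and NO `Prop` fact is minted — the theorems say exactly WHICH subgroup the ambiguity is.

(2) **Both clauses AT THE PARAMETRIC BAD-PAIR Θ-KIT OF RECORD (§3–§4)** — the datum at which abc-iut-L5-lead's TOKEN EDIT v2.6 reads IUTchI:Ex4.4(ii) /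
Ex4.5(i) (abc-iut-w5-d129 p491670/p491911/p491929, which carry no outer-action theorem): p490176's §4/§5 stand-in statements RE-RUN with the
`X̲→`-recipe bad pairs REPLACED by arbitrary bad-pair DATA `B : ∀ v̲ ∈ V̲^bad, BadPairAt v̲` with LAWS `ΛBad` — `outerAction_compatible_thetaOfBadPairs`
(every constituent `g` of `(multKitThetaNFOfBadPairs … B ΛBad ES).thetaPolyBad j v hv`, every representative `ψ` of `g.out`), `…_ambiguity_thetaOfBadPairs`,
`evalHom_outerAction_compatible_thetaOfBadPairs`, `exists_mem_thetaPolyBad_rep_thetaOfBadPairs` (the `∀ g ∀ ψ` quantifiers are INHABITED at every bad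
index: abc-iut-L5-t4 `thetaFamilyNF_nonempty`, `OuterHom.ofHom_surjective`), and `isEvalSection_thetaOfBadPairs_outerAction` on the §4 datum
`baseThetaDatumThetaOfBadPairs B ΛBad ES`'s OWN field `IsEvalSection` between arbitrary isomorphs (abc-iut-L5-t4 `evalBinderThetaNF_isEvalSection_iff` at
`δ := localDataOfBadPairs` BY NAME).  The p490176 stand-in theorems are the special case `B := badPairAtArrow hA` (`rfl`, abc-iut-w5-d129
`baseThetaDatumThetaStandIn_eq_ofBadPairs`) and are NOT restated.  DISPLAYED binders exactly {`CG`, `hS`, `M`, `hA`, `hI`} ∪ {`B`, `ΛBad`} ∪ {`ES`}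
(no `label_rigid` is used: everything is over the DATA part `toEvalSections`); FACT 0; no new LAW.  The joint NON-VACUITY of this binder telescope at one
datum is abc-iut-w4-d054's `exists_badPairs_evalSections_ex44_ex45_regeom₄` (p492055) BY NAME «[model]» — not re-imported here.

HONEST LABELS (carried): (α) is about OUR avatar `Π_v̲ ≤ Π_{C_F}` of `Π^tp_{X̳̲_v}` and the SECTIONS carried by `ES` (content after-merge L3); the ambient is
OUR `ThetaAmb` (J-Θ-1 price, p462621); `B` are DATA of OUR `BadPairAt` interface with LAWS `ΛBad` — parametric, not constructed; a datum over OUR interface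
witnesses OUR binders only and is NOT print's tempered `ℬ^temp(X̳_v̲)⁰`.  Proof-only: no `def`, no instance, no notation, no new binder, no `Prop` fact;
typed ≠ inhabited ≠ proved elsewhere.
-/

namespace Literature.IUT.HodgeTheaters

open CategoryTheory

universe u v w

section EvalSectionsOuterActionsOfBadPairs

variable {F : Type u} {K : Type v} {Fbar : Type w} [Field F] [NumberField F] [Field K] [NumberField K]
  [Algebra F K] [Field Fbar] [Algebra F Fbar] [Algebra K Fbar]
  {E : WeierstrassCurve F} [E.IsElliptic] {l : ℕ} {Pb : BadPlacePredicates K}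
  {D : InitialThetaData F K Fbar E l Pb} {CG : D.geom.pe.CuspGalois} {hS : D.CuspClassesNormaliserStable} [Fact l.Prime]

namespace InitialThetaData

/-! ### §1. The `G_F`-shadow of a commutator (group theory over `augGF : Π_{C_F} ↠ G_F`, `Ker = Δ_{C_F}`) -/

omit [Fact l.Prime] in
variable (D) in
/-- `aug(b)` and `aug(g)` COMMUTE in `G_F` iff the commutator `b⁻¹g⁻¹bg` lies in `Δ_{C_F} = Ker(Π_{C_F} ↠ G_F)` — the two forms in which the ambiguity
of Example 4.4 (ii)'s outer isomorphism is stated below. ([IUTchI] Ex 4.4 (ii) p.107) [claim: Mochizuki2012, status: disputed] -/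
theorem commute_augGF_iff_mem_DeltaC (b g : D.PiC) : Commute (D.augGF b) (D.augGF g) ↔ b⁻¹ * g⁻¹ * b * g ∈ D.DeltaC := by
  rw [← D.augGF_eq_one_iff, ← Commute.inv_inv_iff, ← commutatorElement_eq_one_iff_commute, commutatorElement_def]
  simp only [map_mul, map_inv, inv_inv]

namespace LocalDatum

variable (δ : D.LocalDatum CG hS)

/-! ### §2. The ambiguity of the named outer isomorphism of `π₁^geo` (Example 4.4 (ii)'s bracket), δ-generic -/

/-- **An admissible `a` computes the `G_F`-shadow of the representative**: if `ψ(g) = a⁻¹ga·d_g` with `d_g ∈ Δ_v̲` for all `g ∈ Π_v̲`, then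
`aug(ψ g) = aug(a)⁻¹ · aug(g) · aug(a)` — the homomorphism `G_v̲ → G_v̲` underlying `ψ` is conjugation by `aug(a)`.
([IUTchI] Ex 4.4 (ii) p.107) [claim: Mochizuki2012, status: disputed] -/
theorem augGF_rep_eq_of_admissible (ψ : ↥δ.H →* ↥δ.H) {a : D.PiC}
    (h : ∀ g : ↥δ.H, ∃ d : ↥δ.H, (d : D.PiC) ∈ D.DeltaC ∧ (ψ g : D.PiC) = a⁻¹ * g * a * d) (g : ↥δ.H) :
    D.augGF (ψ g : D.PiC) = (D.augGF a)⁻¹ * D.augGF (g : D.PiC) * D.augGF a := by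
  obtain ⟨d, hd, he⟩ := h g
  rw [he, map_mul, map_mul, map_mul, map_inv, (D.augGF_eq_one_iff _).mpr hd, mul_one]

/-- **Two admissible elements for the SAME representative differ by an element centralising `G_v̲`**: if `a` and `a′` are both admissible for `ψ`,
then `aug(a′a⁻¹)` commutes with `aug(g)` for every `g ∈ Π_v̲`, i.e. `aug(a′a⁻¹) ∈ Z_{G_F}(G_v̲)` where `G_v̲ := aug(Π_v̲)` — the `G`-side of print's
«not necessarily unique, but determined up to finite ambiguity». ([IUTchI] Ex 4.4 (ii) p.107) [claim: Mochizuki2012, status: disputed] -/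
theorem commute_augGF_of_admissible (ψ : ↥δ.H →* ↥δ.H) {a a' : D.PiC}
    (h : ∀ g : ↥δ.H, ∃ d : ↥δ.H, (d : D.PiC) ∈ D.DeltaC ∧ (ψ g : D.PiC) = a⁻¹ * g * a * d)
    (h' : ∀ g : ↥δ.H, ∃ d : ↥δ.H, (d : D.PiC) ∈ D.DeltaC ∧ (ψ g : D.PiC) = a'⁻¹ * g * a' * d) (g : ↥δ.H) :
    Commute (D.augGF (a' * a⁻¹)) (D.augGF (g : D.PiC)) := by
  have e := (δ.augGF_rep_eq_of_admissible ψ h g).symm.trans (δ.augGF_rep_eq_of_admissible ψ h' g)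
  rw [map_mul, map_inv]
  show D.augGF a' * (D.augGF a)⁻¹ * D.augGF (g : D.PiC) = D.augGF (g : D.PiC) * (D.augGF a' * (D.augGF a)⁻¹)
  calc D.augGF a' * (D.augGF a)⁻¹ * D.augGF (g : D.PiC)
      = D.augGF a' * ((D.augGF a)⁻¹ * D.augGF (g : D.PiC) * D.augGF a) * (D.augGF a)⁻¹ := by group
    _ = D.augGF a' * ((D.augGF a')⁻¹ * D.augGF (g : D.PiC) * D.augGF a') * (D.augGF a)⁻¹ := by rw [e]
    _ = D.augGF (g : D.PiC) * (D.augGF a' * (D.augGF a)⁻¹) := by group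

/-- The same in commutator form: `(a′a⁻¹)⁻¹ g⁻¹ (a′a⁻¹) g ∈ Δ_{C_F}` for all `g ∈ Π_v̲`. ([IUTchI] Ex 4.4 (ii) p.107) [claim: Mochizuki2012, status: disputed] -/
theorem comm_mem_DeltaC_of_admissible (ψ : ↥δ.H →* ↥δ.H) {a a' : D.PiC}
    (h : ∀ g : ↥δ.H, ∃ d : ↥δ.H, (d : D.PiC) ∈ D.DeltaC ∧ (ψ g : D.PiC) = a⁻¹ * g * a * d)
    (h' : ∀ g : ↥δ.H, ∃ d : ↥δ.H, (d : D.PiC) ∈ D.DeltaC ∧ (ψ g : D.PiC) = a'⁻¹ * g * a' * d) (g : ↥δ.H) :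
    (a' * a⁻¹)⁻¹ * (g : D.PiC)⁻¹ * (a' * a⁻¹) * g ∈ D.DeltaC :=
  (D.commute_augGF_iff_mem_DeltaC _ _).mp (δ.commute_augGF_of_admissible ψ h h' g)

/-- **Conversely, the whole coset is admissible**: if `a ∈ N(Π_v̲)` is admissible for `ψ` and `b ∈ N(Π_v̲)` has `aug(b)` commuting with `aug(Π_v̲)`,
then `b·a` is admissible for `ψ` — with `d′_g := a⁻¹(b⁻¹g⁻¹bg)a · d_g ∈ Δ_v̲`. ([IUTchI] Ex 4.4 (ii) p.107) [claim: Mochizuki2012, status: disputed] -/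
theorem admissible_mul_of_commute_augGF (ψ : ↥δ.H →* ↥δ.H) {a b : D.PiC}
    (ha : a ∈ Subgroup.normalizer ((δ.H : Subgroup D.PiC) : Set D.PiC))
    (h : ∀ g : ↥δ.H, ∃ d : ↥δ.H, (d : D.PiC) ∈ D.DeltaC ∧ (ψ g : D.PiC) = a⁻¹ * g * a * d)
    (hb : b ∈ Subgroup.normalizer ((δ.H : Subgroup D.PiC) : Set D.PiC))
    (hc : ∀ g : ↥δ.H, Commute (D.augGF b) (D.augGF (g : D.PiC))) (g : ↥δ.H) :
    ∃ d : ↥δ.H, (d : D.PiC) ∈ D.DeltaC ∧ (ψ g : D.PiC) = (b * a)⁻¹ * g * (b * a) * d := by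
  obtain ⟨d, hd, he⟩ := h g
  have hx : b⁻¹ * (g : D.PiC)⁻¹ * b * g ∈ δ.H :=
    Subgroup.mul_mem _ (EvalSections.conj_mem_of_mem_normalizer hb _ (Subgroup.inv_mem _ g.2)) g.2
  have hy : a⁻¹ * (b⁻¹ * (g : D.PiC)⁻¹ * b * g) * a ∈ δ.H := EvalSections.conj_mem_of_mem_normalizer ha _ hx
  refine ⟨⟨a⁻¹ * (b⁻¹ * (g : D.PiC)⁻¹ * b * g) * a, hy⟩ * d, ?_, ?_⟩
  · have hΔ : b⁻¹ * (g : D.PiC)⁻¹ * b * g ∈ D.DeltaC := (D.commute_augGF_iff_mem_DeltaC b g).mp (hc g)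
    rw [← D.augGF_eq_one_iff] at hd hΔ ⊢
    rw [Subgroup.coe_mul, map_mul, hd, mul_one, map_mul, map_mul, hΔ, mul_one, map_inv, inv_mul_cancel]
  · rw [he, Subgroup.coe_mul]
    group

/-- **Changing by an element of `N_{Δ_{C_F}}(Π_v̲)` is always allowed**: if `a ∈ N(Π_v̲)` is admissible for `ψ` and `b ∈ N(Π_v̲) ∩ Δ_{C_F}`, then `b·a`
is admissible (`aug(b) = 1` commutes with everything) — the part of the ambiguity living in `π₁^geo` of `C_F`, where print's finiteness is [SemiAnbd]
Thm 6.4 (NOT asserted here). ([IUTchI] Ex 4.4 (ii) p.107) [claim: Mochizuki2012, status: disputed] -/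
theorem admissible_mul_of_mem_DeltaC (ψ : ↥δ.H →* ↥δ.H) {a b : D.PiC}
    (ha : a ∈ Subgroup.normalizer ((δ.H : Subgroup D.PiC) : Set D.PiC))
    (h : ∀ g : ↥δ.H, ∃ d : ↥δ.H, (d : D.PiC) ∈ D.DeltaC ∧ (ψ g : D.PiC) = a⁻¹ * g * a * d)
    (hb : b ∈ Subgroup.normalizer ((δ.H : Subgroup D.PiC) : Set D.PiC)) (hbΔ : b ∈ D.DeltaC) (g : ↥δ.H) :
    ∃ d : ↥δ.H, (d : D.PiC) ∈ D.DeltaC ∧ (ψ g : D.PiC) = (b * a)⁻¹ * g * (b * a) * d :=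
  δ.admissible_mul_of_commute_augGF ψ ha h hb (fun g => by rw [(D.augGF_eq_one_iff b).mpr hbΔ]; exact Commute.one_left _) g

/-- **THE AMBIGUITY OF THE OUTER ISOMORPHISM, EXACTLY** (Example 4.4 (ii) «[not necessarily unique, but determined up to finite ambiguity …]», in the
avatar): fix a representative `ψ` of a constituent of `φ^Θ_{v̲_j}` and ONE admissible `a ∈ N(Π_v̲)` (p490176 names one).  Then `a′ ∈ Π_{C_F}` is an
automorphism of `𝒟_v̲` admissible for `ψ` — `a′ ∈ N(Π_v̲)` and `ψ(g) = a′⁻¹ga′·d′_g`, `d′_g ∈ Δ_v̲` — IF AND ONLY IF `b := a′a⁻¹ ∈ N(Π_v̲)` and `aug(b)`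
centralises `G_v̲ = aug(Π_v̲)` in `G_F`.  So the admissible outer isomorphisms `x ↦ a′⁻¹xa′` of `π₁^geo = Δ_v̲` form ONE coset `A·a` of the subgroup
`A = {b ∈ N(Π_v̲) | aug(b) ∈ Z_{G_F}(G_v̲)} ⊇ N_{Δ_{C_F}}(Π_v̲)`; finiteness of its image (print: [SemiAnbd] Thm 6.4; classically `Z_{G_F}(G_v̲) = 1`) is
NOT asserted. ([IUTchI] Ex 4.4 (ii) p.107) [claim: Mochizuki2012, status: disputed] -/
theorem outerIso_admissible_iff (ψ : ↥δ.H →* ↥δ.H) {a : D.PiC}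
    (ha : a ∈ Subgroup.normalizer ((δ.H : Subgroup D.PiC) : Set D.PiC))
    (h : ∀ g : ↥δ.H, ∃ d : ↥δ.H, (d : D.PiC) ∈ D.DeltaC ∧ (ψ g : D.PiC) = a⁻¹ * g * a * d) (a' : D.PiC) :
    (a' ∈ Subgroup.normalizer ((δ.H : Subgroup D.PiC) : Set D.PiC) ∧
        ∀ g : ↥δ.H, ∃ d : ↥δ.H, (d : D.PiC) ∈ D.DeltaC ∧ (ψ g : D.PiC) = a'⁻¹ * g * a' * d) ↔
      (a' * a⁻¹ ∈ Subgroup.normalizer ((δ.H : Subgroup D.PiC) : Set D.PiC) ∧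
        ∀ g : ↥δ.H, Commute (D.augGF (a' * a⁻¹)) (D.augGF (g : D.PiC))) := by
  constructor
  · rintro ⟨ha', h'⟩
    exact ⟨Subgroup.mul_mem _ ha' (Subgroup.inv_mem _ ha), δ.commute_augGF_of_admissible ψ h h'⟩
  · rintro ⟨hb, hc⟩
    have hadm := δ.admissible_mul_of_commute_augGF ψ ha h hb hc
    rw [inv_mul_cancel_right] at hadm
    refine ⟨?_, hadm⟩
    rw [← inv_mul_cancel_right a' a]
    exact Subgroup.mul_mem _ hb ha

/-- **Changing the representative** («well-defined, up to composition with an inner automorphism»): if `a` is admissible for `ψ` and `ψ′ = c·ψ(·)·c⁻¹`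
with `c ∈ Π_v̲`, then `a·c⁻¹` is admissible for `ψ′` — the coset `A·a` of admissible elements moves by `Π_v̲` with the representative, so for the
OUTER homomorphism the admissible set is `A·a·Π_v̲ = (A·Π_v̲)·a`. ([IUTchI] Ex 4.4 (ii) p.107) [claim: Mochizuki2012, status: disputed] -/
theorem admissible_mul_inv_of_innerEquiv {ψ ψ' : ↥δ.H →* ↥δ.H} {c : ↥δ.H} (hψ' : ∀ x, ψ' x = c * ψ x * c⁻¹) {a : D.PiC}
    (h : ∀ g : ↥δ.H, ∃ d : ↥δ.H, (d : D.PiC) ∈ D.DeltaC ∧ (ψ g : D.PiC) = a⁻¹ * g * a * d) (g : ↥δ.H) :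
    ∃ d : ↥δ.H, (d : D.PiC) ∈ D.DeltaC ∧ (ψ' g : D.PiC) = (a * (c : D.PiC)⁻¹)⁻¹ * g * (a * (c : D.PiC)⁻¹) * d := by
  obtain ⟨d, hd, he⟩ := h g
  refine ⟨c * d * c⁻¹, ?_, ?_⟩
  · rw [← D.augGF_eq_one_iff] at hd ⊢
    rw [Subgroup.coe_mul, Subgroup.coe_mul, Subgroup.coe_inv, map_mul, map_mul, map_inv, hd, mul_one, mul_inv_cancel]
  · rw [hψ' g, Subgroup.coe_mul, Subgroup.coe_mul, Subgroup.coe_inv, he, Subgroup.coe_mul, Subgroup.coe_mul, Subgroup.coe_inv]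
    group

end LocalDatum

namespace EvalSections

variable {δ : D.LocalDatum CG hS} {Gv : Subgroup (Fbar ≃ₐ[F] Fbar)} (ES : EvalSections δ Gv)

/-- **Example 4.4 (ii) + Example 4.5 (i) (bad place) WITH THE AMBIGUITY, over the evaluation-section DATA**: for every constituent `f ∈ thetaClass j` of
`φ^Θ_{v̲_j}` and every representative `ψ`, (α) there is an admissible `a ∈ N(Π_v̲)` (the outer isomorphism `x ↦ a⁻¹xa` of `π₁^geo` NAMED, p490176), the
admissible elements are EXACTLY those `a′` with `a′a⁻¹ ∈ N(Π_v̲)` and `aug(a′a⁻¹) ∈ Z_{G_F}(G_v̲)` («determined up to [this] ambiguity»), `ψ` kills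
`π₁^geo`, and (β) EVERY element of `N(Π_v̲)` — in particular every admissible `a′` — has slope class `1 ∈ 𝔽_l^⋇` (laws (L1)(L2) of `δ`), so the bijection
`LabCusp(𝒟_{v̲_j}) ⥲ LabCusp(𝒟_{>,v̲})` induced through ANY admissible outer isomorphism is the identity on Prop 4.2's canonical labels: Example 4.5 (i)'s
isomorphism of `𝔽_l^⋇`-torsors at `v ∈ 𝕍^bad` is well defined. ([IUTchI] Ex 4.5 (i) p.108) [claim: Mochizuki2012, status: disputed] -/
theorem outerAction_compatible_ambiguity_of_mem_thetaClass {j : FlAbs l} {f : OuterHom δ.H δ.H} (hf : f ∈ ES.thetaClass j)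
    (ψ : ↥δ.H →* ↥δ.H) (hψ : OuterHom.ofHom ψ = f) :
    ∃ (a : D.PiC) (ha : a ∈ Subgroup.normalizer ((δ.H : Subgroup D.PiC) : Set D.PiC)),
      (∀ g : ↥δ.H, ∃ d : ↥δ.H, (d : D.PiC) ∈ D.DeltaC ∧ (ψ g : D.PiC) = a⁻¹ * g * a * d) ∧
      (∀ a' : D.PiC,
        (a' ∈ Subgroup.normalizer ((δ.H : Subgroup D.PiC) : Set D.PiC) ∧
            ∀ g : ↥δ.H, ∃ d : ↥δ.H, (d : D.PiC) ∈ D.DeltaC ∧ (ψ g : D.PiC) = a'⁻¹ * g * a' * d) ↔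
          (a' * a⁻¹ ∈ Subgroup.normalizer ((δ.H : Subgroup D.PiC) : Set D.PiC) ∧
            ∀ g : ↥δ.H, Commute (D.augGF (a' * a⁻¹)) (D.augGF (g : D.PiC)))) ∧
      (∀ x : ↥δ.H, (x : D.PiC) ∈ D.DeltaC → ψ x = 1) ∧
      D.slopeStar CG hS ⟨a, δ.law.normalizer_le ha⟩ = 1 ∧
      ∀ (a' : D.PiC) (ha' : a' ∈ Subgroup.normalizer ((δ.H : Subgroup D.PiC) : Set D.PiC)),
        D.slopeStar CG hS ⟨a', δ.law.normalizer_le ha'⟩ = 1 := by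
  obtain ⟨a, ha, h⟩ := ES.outerAction_compatible_of_mem_thetaClass hf ψ hψ
  exact ⟨a, ha, h, δ.outerIso_admissible_iff ψ ha h, fun x hx => ES.rep_eq_one_of_mem_DeltaC_of_mem_thetaClass hf ψ hψ hx,
    slopeStar_eq_one_of_mem_normalizer ha, fun a' ha' => slopeStar_eq_one_of_mem_normalizer ha'⟩

end EvalSections

/-! ### §3. AT THE PARAMETRIC BAD-PAIR Θ-KIT `baseKitThetaNFOfBadPairs CG hS M hA hI B ΛBad` (abc-iut-w5-d129's (C″)-OfBadPairs datum): every constituent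
of the kit's `φ^Θ_{v̲_j}` -/

variable (D CG hS)
variable (M : D.TorsionMonodromy) (hA : D.geom.pe.ArrowCoveringClaims)
  (hI : ∀ k ∈ D.geom.pe.inertia D.geom.pe.ε1, M.tau (D.geom.embK k) = 0)
  (B : ∀ v, v ∈ D.indexCopyBad → D.BadPairAt v) (ΛBad : ∀ v (h : v ∈ D.indexCopyBad), D.LocalArrowLaw CG hS (B v h).H)
  {Gv : D.IndexCopy → Subgroup (Fbar ≃ₐ[F] Fbar)}
  (ES : ∀ v, v ∈ D.indexCopyBad → EvalSectionBinder (D.localDataOfBadPairs CG hS M hA hI B ΛBad v) (Gv v))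

/-- **Examples 4.4 (ii) / 4.5 (i) (bad place) AT THE PARAMETRIC BAD-PAIR Θ-KIT** — DISPLAYED binders {`CG`, `hS`, `M`, `hA`, `hI`} ∪ {`B`, `ΛBad`} ∪
{`ES`}: every constituent `g` of the multiplicative kit's `φ^Θ_{v̲_j}` (`(D.multKitThetaNFOfBadPairs CG hS M hA hI B ΛBad ES).thetaPolyBad j v hv`; by law
(γ) `thetaAgrees_thetaOfBadPairs` these ARE Example 4.4's poly-morphisms of the §4 datum `baseThetaDatumThetaOfBadPairs B ΛBad ES` read through the
dictionary) is a DEGENERATE morphism of `ThetaAmb` whose outer homomorphism `g.out : Π_v̲ → Π_v̲`, on every representative `ψ`, (α) is compatible with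
the outer actions on `π₁^geo = Π_v̲ ∩ Δ_{C_F}` through the NAMED outer isomorphism `x ↦ a⁻¹xa`, `a ∈ N(Π_v̲)`, kills `π₁^geo`, and (β) has `slopeStar a = 1`
(the induced bijection of label classes of cusps is the identity on canonical labels).  The p490176 stand-in statement is the case `B := badPairAtArrow`.
([IUTchI] Ex 4.4 (ii) p.107) [claim: Mochizuki2012, status: disputed] -/
theorem outerAction_compatible_thetaOfBadPairs {v : D.IndexCopy} (hv : v ∈ D.indexCopyBad) (j : Fin (lStar l))
    {g : (D.baseKitThetaNFOfBadPairs CG hS M hA hI B ΛBad).model v ⟶ (D.baseKitThetaNFOfBadPairs CG hS M hA hI B ΛBad).model v}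
    (hg : g ∈ (D.multKitThetaNFOfBadPairs CG hS M hA hI B ΛBad ES).thetaPolyBad j v hv)
    (ψ : ↥(D.localDataOfBadPairs CG hS M hA hI B ΛBad v).H →* ↥(D.localDataOfBadPairs CG hS M hA hI B ΛBad v).H)
    (hψ : OuterHom.ofHom ψ = g.out) :
    g.deg = true ∧
    ∃ (a : D.PiC) (ha : a ∈ Subgroup.normalizer (((D.localDataOfBadPairs CG hS M hA hI B ΛBad v).H : Subgroup D.PiC) : Set D.PiC)),
      D.slopeStar CG hS ⟨a, (D.localDataOfBadPairs CG hS M hA hI B ΛBad v).law.normalizer_le ha⟩ = 1 ∧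
      (∀ x : ↥(D.localDataOfBadPairs CG hS M hA hI B ΛBad v).H, (x : D.PiC) ∈ D.DeltaC → ψ x = 1) ∧
      ∀ g' : ↥(D.localDataOfBadPairs CG hS M hA hI B ΛBad v).H, ∃ d : ↥(D.localDataOfBadPairs CG hS M hA hI B ΛBad v).H,
        (d : D.PiC) ∈ D.DeltaC ∧ (ψ g' : D.PiC) = a⁻¹ * g' * a * d := by
  change g.deg = true ∧ g.out ∈ (ES v hv).thetaClass (FlStar.toFlAbs l (FlStar.ofFin l j)) at hg
  exact ⟨hg.1, (ES v hv).toEvalSections.outerAction_compatible_labels_of_mem_thetaClass hg.2 ψ hψ⟩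

/-- **… WITH THE AMBIGUITY OF THE OUTER ISOMORPHISM, at the parametric bad-pair Θ-kit**: for every constituent `g` and representative `ψ` of `g.out`, the
admissible `a′` are EXACTLY those with `a′a⁻¹ ∈ N(Π_v̲)` and `aug(a′a⁻¹) ∈ Z_{G_F}(G_v̲)` for the named `a`, and EVERY element of `N(Π_v̲)` has slope class
`1` — Example 4.5 (i)'s `LabCusp` bijection at `v̲ ∈ V̲^bad` does not depend on the choice within the ambiguity.
([IUTchI] Ex 4.5 (i) p.108) [claim: Mochizuki2012, status: disputed] -/
theorem outerAction_compatible_ambiguity_thetaOfBadPairs {v : D.IndexCopy} (hv : v ∈ D.indexCopyBad) (j : Fin (lStar l))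
    {g : (D.baseKitThetaNFOfBadPairs CG hS M hA hI B ΛBad).model v ⟶ (D.baseKitThetaNFOfBadPairs CG hS M hA hI B ΛBad).model v}
    (hg : g ∈ (D.multKitThetaNFOfBadPairs CG hS M hA hI B ΛBad ES).thetaPolyBad j v hv)
    (ψ : ↥(D.localDataOfBadPairs CG hS M hA hI B ΛBad v).H →* ↥(D.localDataOfBadPairs CG hS M hA hI B ΛBad v).H)
    (hψ : OuterHom.ofHom ψ = g.out) :
    ∃ (a : D.PiC) (ha : a ∈ Subgroup.normalizer (((D.localDataOfBadPairs CG hS M hA hI B ΛBad v).H : Subgroup D.PiC) : Set D.PiC)),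
      (∀ g' : ↥(D.localDataOfBadPairs CG hS M hA hI B ΛBad v).H, ∃ d : ↥(D.localDataOfBadPairs CG hS M hA hI B ΛBad v).H,
        (d : D.PiC) ∈ D.DeltaC ∧ (ψ g' : D.PiC) = a⁻¹ * g' * a * d) ∧
      (∀ a' : D.PiC,
        (a' ∈ Subgroup.normalizer (((D.localDataOfBadPairs CG hS M hA hI B ΛBad v).H : Subgroup D.PiC) : Set D.PiC) ∧
            ∀ g' : ↥(D.localDataOfBadPairs CG hS M hA hI B ΛBad v).H, ∃ d : ↥(D.localDataOfBadPairs CG hS M hA hI B ΛBad v).H,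
              (d : D.PiC) ∈ D.DeltaC ∧ (ψ g' : D.PiC) = a'⁻¹ * g' * a' * d) ↔
          (a' * a⁻¹ ∈ Subgroup.normalizer (((D.localDataOfBadPairs CG hS M hA hI B ΛBad v).H : Subgroup D.PiC) : Set D.PiC) ∧
            ∀ g' : ↥(D.localDataOfBadPairs CG hS M hA hI B ΛBad v).H, Commute (D.augGF (a' * a⁻¹)) (D.augGF (g' : D.PiC)))) ∧
      (∀ x : ↥(D.localDataOfBadPairs CG hS M hA hI B ΛBad v).H, (x : D.PiC) ∈ D.DeltaC → ψ x = 1) ∧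
      D.slopeStar CG hS ⟨a, (D.localDataOfBadPairs CG hS M hA hI B ΛBad v).law.normalizer_le ha⟩ = 1 ∧
      ∀ (a' : D.PiC) (ha' : a' ∈ Subgroup.normalizer (((D.localDataOfBadPairs CG hS M hA hI B ΛBad v).H : Subgroup D.PiC) : Set D.PiC)),
        D.slopeStar CG hS ⟨a', (D.localDataOfBadPairs CG hS M hA hI B ΛBad v).law.normalizer_le ha'⟩ = 1 := by
  change g.deg = true ∧ g.out ∈ (ES v hv).thetaClass (FlStar.toFlAbs l (FlStar.ofFin l j)) at hg
  exact (ES v hv).toEvalSections.outerAction_compatible_ambiguity_of_mem_thetaClass hg.2 ψ hψ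

/-- **The base constituent at the parametric bad-pair Θ-kit**: `[s_j ∘ aug]` is compatible with the outer actions on `π₁^geo` through the IDENTITY outer
isomorphism: `φ^Θ_{v̲_j}(g) = g · d_g`, `d_g ∈ Δ_v̲`. ([IUTchI] Ex 4.4 (ii) p.107) [claim: Mochizuki2012, status: disputed] -/
theorem evalHom_outerAction_compatible_thetaOfBadPairs {v : D.IndexCopy} (hv : v ∈ D.indexCopyBad) (j : FlAbs l)
    (g : ↥(D.localDataOfBadPairs CG hS M hA hI B ΛBad v).H) :
    ∃ d : ↥(D.localDataOfBadPairs CG hS M hA hI B ΛBad v).H, (d : D.PiC) ∈ D.DeltaC ∧ (ES v hv).evalHom j g = g * d :=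
  (ES v hv).toEvalSections.exists_evalHom_eq_mul j g

open Classical in
/-- **The `∀ g ∀ ψ` quantifiers of the two theorems above are INHABITED at every bad index** (so nothing there is vacuous in the constituents): for every
`v̲ ∈ V̲^bad` and `j` there IS a constituent of the kit's `φ^Θ_{v̲_j}` (abc-iut-L5-t4 `thetaFamilyNF_nonempty`: `⟨true, 𝟙, [s_{j}∘aug]⟩`) and its outer
homomorphism HAS a representative (`OuterHom.ofHom_surjective`). ([IUTchI] Ex 4.4 (i) p.106) [claim: Mochizuki2012, status: disputed] -/
theorem exists_mem_thetaPolyBad_rep_thetaOfBadPairs (v : D.IndexCopy) (hv : v ∈ D.indexCopyBad) (j : Fin (lStar l)) :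
    ∃ (g : (D.baseKitThetaNFOfBadPairs CG hS M hA hI B ΛBad).model v ⟶ (D.baseKitThetaNFOfBadPairs CG hS M hA hI B ΛBad).model v)
      (ψ : ↥(D.localDataOfBadPairs CG hS M hA hI B ΛBad v).H →* ↥(D.localDataOfBadPairs CG hS M hA hI B ΛBad v).H),
      g ∈ (D.multKitThetaNFOfBadPairs CG hS M hA hI B ΛBad ES).thetaPolyBad j v hv ∧ OuterHom.ofHom ψ = g.out := by
  haveI := M.normal_PiXund_subgroupOf_PiXK
  obtain ⟨g, hg⟩ := D.thetaFamilyNF_nonempty (D.toFlStarGlobal_surjective_of_torsionMonodromy M) D.indexCopyBad D.indexCopyArc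
    (D.localDataOfBadPairs CG hS M hA hI B ΛBad) ES v hv (FlStar.toFlAbs l (FlStar.ofFin l j))
  obtain ⟨ψ, hψ⟩ := OuterHom.ofHom_surjective g.out
  exact ⟨g, ψ, hg, hψ⟩

/-! ### §4. On the §4 datum `baseThetaDatumThetaOfBadPairs B ΛBad ES` itself: every evaluation-section morphism `†𝒟_v̲ → ‡𝒟_v̲` between arbitrary isomorphs -/

open Classical in
/-- **Example 4.4 (ii) AS PRINTED, read on abc-iut-L5-t3's §4 field `IsEvalSection` (BaseBridgeModels p405606) AT abc-iut-w5-d129's §4 DATUM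
`𝔡 := D.baseThetaDatumThetaOfBadPairs CG hS M hA hI B ΛBad ES` over the PARAMETRIC bad-pair Θ-kit**: a constituent `f : †𝒟_v̲ → ‡𝒟_v̲` of `φ^Θ_{v̲_j}`
between ARBITRARY isomorphs of `𝒟_v̲` is «obtained by composing with arbitrary isomorphisms» a DEGENERATE model endomorphism `g` (abc-iut-L5-t4
`evalBinderThetaNF_isEvalSection_iff` at `δ := localDataOfBadPairs`), and the outer homomorphism `Π_v̲ → Π_v̲` of `g`, on every representative `ψ`, is
compatible with the outer actions on `π₁^geo = Π_v̲ ∩ Δ_{C_F}` through a NAMED outer isomorphism `x ↦ a⁻¹xa`, `a ∈ N(Π_v̲)` (α), kills `π₁^geo`, and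
`slopeStar a = 1` (β — Ex 4.5 (i), bad place).  DISPLAYED binders {`CG`, `hS`, `M`, `hA`, `hI`} ∪ {`B`, `ΛBad`} ∪ {`ES`}.
([IUTchI] Ex 4.4 (ii) p.107) [claim: Mochizuki2012, status: disputed] -/
theorem isEvalSection_thetaOfBadPairs_outerAction {v : D.IndexCopy} (hv : v ∈ D.indexCopyBad) (j : FlAbs l)
    {X Y : (D.baseKitThetaNFOfBadPairs CG hS M hA hI B ΛBad).LocalObj v} {f : X ⟶ Y}
    (hf : (D.baseThetaDatumThetaOfBadPairs CG hS M hA hI B ΛBad ES).IsEvalSection (v := v) (X := X) (Y := Y) hv j f) :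
    ∃ (a : X.obj ≅ (D.baseKitThetaNFOfBadPairs CG hS M hA hI B ΛBad).model v)
      (b : (D.baseKitThetaNFOfBadPairs CG hS M hA hI B ΛBad).model v ≅ Y.obj)
      (g : (D.baseKitThetaNFOfBadPairs CG hS M hA hI B ΛBad).model v ⟶ (D.baseKitThetaNFOfBadPairs CG hS M hA hI B ΛBad).model v),
      f.hom = a.hom ≫ g ≫ b.hom ∧ g.deg = true ∧
      ∀ ψ : ↥(D.localDataOfBadPairs CG hS M hA hI B ΛBad v).H →* ↥(D.localDataOfBadPairs CG hS M hA hI B ΛBad v).H, OuterHom.ofHom ψ = g.out →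
        ∃ (a' : D.PiC) (ha' : a' ∈ Subgroup.normalizer (((D.localDataOfBadPairs CG hS M hA hI B ΛBad v).H : Subgroup D.PiC) : Set D.PiC)),
          D.slopeStar CG hS ⟨a', (D.localDataOfBadPairs CG hS M hA hI B ΛBad v).law.normalizer_le ha'⟩ = 1 ∧
          (∀ x : ↥(D.localDataOfBadPairs CG hS M hA hI B ΛBad v).H, (x : D.PiC) ∈ D.DeltaC → ψ x = 1) ∧
          ∀ g' : ↥(D.localDataOfBadPairs CG hS M hA hI B ΛBad v).H, ∃ d : ↥(D.localDataOfBadPairs CG hS M hA hI B ΛBad v).H,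
            (d : D.PiC) ∈ D.DeltaC ∧ (ψ g' : D.PiC) = a'⁻¹ * g' * a' * d := by
  haveI := M.normal_PiXund_subgroupOf_PiXK
  obtain ⟨a, b, g, hg, he⟩ := (D.evalBinderThetaNF_isEvalSection_iff (D.toFlStarGlobal_surjective_of_torsionMonodromy M)
    D.indexCopyBad D.indexCopyArc (D.localDataOfBadPairs CG hS M hA hI B ΛBad) ES D.five_le_l hv j f.hom).mp hf
  exact ⟨a, b, g, he, hg.1, fun ψ hψ => (ES v hv).toEvalSections.outerAction_compatible_labels_of_mem_thetaClass hg.2 ψ hψ⟩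

end InitialThetaData

end EvalSectionsOuterActionsOfBadPairs

end Literature.IUT.HodgeTheaters
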